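import Mathlib.NumberTheory.Padics.HeightOneSpectrum
import Mathlib.Data.Nat.Factorization.Basic
import Literature.NumberTheory.GaloisRepresentations.GaloisRep
import Literature.NumberTheory.GaloisRepresentations.ModNCyclotomicCharacter
import Literature.NumberTheory.GaloisRepresentations.CyclotomicLevels
import Literature.NumberTheory.GaloisRepresentations.LocalReciprocity
import Literature.NumberTheory.GaloisRepresentations.UnitIdeles
import Literature.NumberTheory.GaloisRepresentations.HeckeCharacterOfRayClass
import Literature.NumberTheory.GaloisRepresentations.RayClassGroup
import Literature.NumberTheory.NumberFields.IdeleStabilizerOfLatticePoints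
import Literature.NumberTheory.NumberFields.FiniteIdeleCongruenceSubgroupBasis
import Literature.NumberTheory.NumberFields.PrincipalIdelesFiniteClosure
import HarnessLib

/-!
# The cyclotomic character as a finite idèle of `ℚ`: `χ_cyc : Gal(ℚ^al/ℚ) → Ẑ^× ⊂ 𝔸^×_{ℚ,f}`
# (Milne, *Complex Multiplication*, Ch. II §9, before Lemma 9.4)

Topic `NumberTheory/NumberFields`; namespace `Literature.NumberTheory.NumberFields`.  Lane `lit-hodgefound` (Track 2,
Layer A3 skeleton seat `skel-3`, row A3-G40 FILE 1 of 2).  ONE definition with a body (`cyclotomicFiniteIdele`, plus its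
factorisation `cyclotomicFiniteIdeleAb` through `Γ_ℚ^ab` and the auxiliary local component `cyclotomicLocalUnit`) and
theorems, all proved; no named fact, no `sorry`, no new axiom (D-0026, net debt 0).

## The print

J. S. Milne, *Complex Multiplication* (course notes, version of July 14, 2020; open text `paper:url-8ccc30e4daab`,
p0076 L25–L28) [MilneCM2006], Ch. II §9 «More preliminaries from algebraic number theory»:

> «Let `χ_cyc : Gal(ℚ^al/ℚ) → Ẑ^×` be the cyclotomic character: `σζ = ζ^{χ_cyc(σ)}` for all roots `ζ` of `1` in `ℂ`.
> LEMMA 9.4 For any `σ ∈ Gal(ℚ^al/ℚ)`, `art_ℚ(χ_cyc(σ)) = σ|ℚ^ab`.»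

and Lemmas 9.5 / 9.7 («`Nm_{E/ℚ}(s) ∈ χ_cyc(art_E(s)) · ℚ_{>0}`», «`N_Φ(s) · ι_E N_Φ(s) ∈ χ_cyc(art_{E*}(s)) · ℚ_{>0}`»),
in which `χ_cyc(σ) ∈ Ẑ^× = ∏_p ℤ_p^×` is regarded as an element of the finite idèle group `𝔸^×_{ℚ,f} ⊃ Ẑ^×`.  This
file supplies THE OBJECT — `χ_cyc` as ONE homomorphism into the finite idèles of `ℚ`, DEFINED, as printed, by the
Galois action on roots of unity — and its defining property at every finite level; the sequel
`…NumberFields/IdelicArtinMapCyclotomicCharacter` proves Lemma 9.4 and the `χ_cyc`-clauses of 9.5 / 9.7.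

## Setting (the tree's vocabulary) and construction

`Γ_ℚ = Field.absoluteGaloisGroup ℚ` acting on `ℚ̄ = AlgebraicClosure ℚ`; for a finite place `v` of `ℚ`
(`v : HeightOneSpectrum (𝓞 ℚ)`) write `p_v = Rat.HeightOneSpectrum.natGenerator v` for the rational prime under it
(Mathlib: `v.asIdeal ↔ p_v`, `Rat.HeightOneSpectrum.primesEquiv`), `ℚ_v = v.adicCompletion ℚ ⊃ 𝒪_v =
v.adicCompletionIntegers ℚ`, and `e_v : 𝒪_v ≃A[ℤ] ℤ_[p_v]` for Mathlib's continuous `ℤ`-algebra isomorphism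
`Rat.HeightOneSpectrum.adicCompletionIntegers.padicIntEquiv v` (`Mathlib/NumberTheory/Padics/HeightOneSpectrum`).
The `p`-ADIC cyclotomic character is the GalRep trunk's CONTINUOUS `GaloisRep.cyclotomicCharacter ℚ p : Γ_ℚ →ₜ* ℤ_[p]ˣ`
(Mathlib's `cyclotomicCharacter (AlgebraicClosure ℚ) p`: `σ • t = t ^ (χ_p(σ) mod p^k)` for `t ^ p^k = 1`,
`GaloisRep.cyclotomicCharacter_spec`).  DEFINITION: `χ_cyc(σ)` is the finite idèle whose `v`-component is
`e_v⁻¹(χ_{p_v}(σ)) ∈ 𝒪_v^×` — so `χ_cyc` is defined by the action of `σ` on the `p`-power roots of unity for every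
`p`, exactly Milne's «`σζ = ζ^{χ_cyc(σ)}` for all roots `ζ` of `1`» read prime by prime (`μ_N = ∏_p μ_{p^{v_p N}}`).
The finite idèles are `(FiniteAdeleRing (𝓞 ℚ) ℚ)ˣ`; `Ẑ^×` is the subgroup of unit finite idèles
`ker (IdeleIdeal.toIdealUnits (𝓞 ℚ) ℚ)` (`ord_v = 0` everywhere); Neukirch's congruence subgroups
`IdeleAction.congruenceUnits (N) = ∏_p (1 + N ℤ_p)^× ∩ Ẑ^×`; full idèles `𝕀_ℚ = GaloisRepresentations.ideleGroup ℚ`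
with `y ↦ (1, y)` (`Units.map (MonoidHom.inr …)`), `unitIdeles`, `congruenceIdeles (N)` (Shimura's `W_𝔪`: conditions
at `p ∣ N` and positivity at `∞` only) and `principalIdele`.

## What is proved

* §1 THE LOCAL COMPONENT `cyclotomicLocalUnit v : Γ_ℚ →* 𝒪_v^×` (`χ_v(σ) = e_v⁻¹(χ_{p_v}(σ))`, `coe_cyclotomicLocalUnit`,
  `toPadic_coe_cyclotomicLocalUnit` for the trunk's `Rat.toPadic`) and its dictionary with `ℤ_[p]`:
  `(χ_{p}(σ) mod p^k) = n ↔ (∀ t ∈ ℚ̄, t^{p^k} = 1 → σ • t = t^n)` (`toZModPow_cyclotomicCharacter_eq_natCast_iff`),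
  `p_v^k ∣ χ_v(σ) - n in 𝒪_v ↔ …` (`pow_dvd_cyclotomicLocalUnit_sub_natCast_iff`) and in valuation form
  `|χ_v(σ) - n|_v ≤ |p_v|^k ↔ …` (`valued_cyclotomicLocalUnit_sub_natCast_le_iff`).
* §2 THE OBJECT `cyclotomicFiniteIdele : Γ_ℚ →* (𝔸_{ℚ,f})^×`, components (`coe_cyclotomicFiniteIdele_apply`), values in
  `Ẑ^×` (`cyclotomicFiniteIdele_mem_ker_toIdealUnits`, `valued_cyclotomicFiniteIdele_apply`), the full idèle
  `cyclotomicIdele σ = (1, χ_cyc σ) ∈ unitIdeles ℚ`; and IN THE TRUNK'S COORDINATES on `𝕀_ℚ` (Tate's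
  `J_ℚ ≅ ℚ^* × ℝ_+^* × ∏_p U_p`, `GaloisRepresentations/HeckeCharacterProofs`): **`padicUnitPart_cyclotomicIdele`
  (the `p`-component is `χ_p(σ)`), `redMod_cyclotomicIdele : Rat.redMod N (1, χ_cyc σ) = χ_N(σ)` and
  `rayClassHom_cyclotomicIdele` — «`σζ = ζ^{χ_cyc(σ)}`»: `χ_cyc(σ) mod N` IS the mod-`N` cyclotomic character
  `modNCyclotomicCharacter ℚ N σ ∈ (ℤ/N)ˣ` for every `N ≥ 1`** (the printed definition, `Ẑ^× = lim (ℤ/N)^×`).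
* §3 THE DEFINING PROPERTY AT LEVEL `N` IN CONGRUENCE-SUBGROUP FORM (the hypothesis of Tate's «`ζ^{ψ(x)} = ζ^{u^{-1}}`» in
  `…IdelicArtinMapOnRootsOfUnity`): **`principalIdele_inv_mul_cyclotomicIdele_mem_congruenceIdeles_iff`:
  `(n)⁻¹ · (1, χ_cyc σ) ∈ W_{(N)} ↔ σ • t = t^n` for all `t ∈ μ_N(ℚ̄)`** («`χ_cyc(σ) ≡ n mod^× N`»; the converse is
  local-to-global through `Nat.dvd_iff_prime_pow_dvd_dvd`), the existence form at every level
  (`exists_principalIdele_inv_mul_cyclotomicIdele_mem_congruenceIdeles`, exponent `≡ χ_N(σ)`), and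
  **`cyclotomicFiniteIdele_mem_congruenceUnits_iff`: `χ_cyc(σ) ∈ I^{(N)} ↔ σ` fixes `μ_N(ℚ̄)`** (`= rootsOfUnityFixer ℚ N`).
* §4 UNIQUENESS (`eq_cyclotomicFiniteIdele_of_forall`): a unit finite idèle with the level-`N` property for every `N` IS
  `χ_cyc(σ)` (`Ẑ^×` is separated by the `I^{(N)}`, `FiniteIdeleClosure.eq_one_of_forall_mem_congruenceUnits_span_natCast`);
  with the bridge `IdeleAction.mem_congruenceUnits_of_units_map_inr_mem_congruenceIdeles` (`(1, w) ∈ W_𝔪 ⇒ w ∈ I^𝔪`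
  for unit finite idèles) and its converse.
* §5 CONTINUITY (`continuous_cyclotomicFiniteIdele`, `continuous_cyclotomicIdele`: the preimage of `I^𝔪 ⊇ I^{(N𝔪)}`
  contains the open `rootsOfUnityFixer ℚ (N𝔪)`, and the `I^𝔪` are a basis of `1`, `…FiniteIdeleCongruenceSubgroupBasis`);
  the kernel is `⋂_N Gal(ℚ̄/ℚ(μ_N))` (`cyclotomicFiniteIdele_eq_one_iff`); an automorphism inverting all roots of unity, in
  particular a complex conjugation, goes to `-1` (`cyclotomicFiniteIdele_eq_neg_one_of_forall_smul_eq_inv`,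
  `cyclotomicFiniteIdele_of_isComplexConjugation`).
* §6 FACTORISATION THROUGH `Γ_ℚ^ab`: `χ_cyc` kills `closure [Γ_ℚ, Γ_ℚ]` (its elements fix every `μ_N`), whence
  `cyclotomicFiniteIdeleAb : absoluteGaloisGroupAbelianization ℚ →* (𝔸_{ℚ,f})^×` with
  `cyclotomicFiniteIdeleAb_absGaloisAbProj` — the map of Lemma 9.4.

NOT HERE: Lemma 9.4 itself and the class-field-theoretic consequences (the sequel); `χ_cyc` of a Frobenius (only
defined up to inertia); the `ℚ_ℓ`-valued characters of the Motives layer (`Motives.padicCyclotomicCharacter`, G17) are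
the `ℓ`-components pushed to `ℚ_ℓˣ` and are not restated.

## References

* J. S. Milne, *Complex Multiplication* (course notes, 2006; version July 14, 2020), Ch. II §9, p. 76 (definition of
  `χ_cyc`, Lemma 9.4), Lemmas 9.5, 9.7. [MilneCM2006]
* J.-P. Serre, *Abelian ℓ-adic representations and elliptic curves* (1968), Ch. I §1.2 (the `ℓ`-adic cyclotomic
  character). [SerreAbelianLadic1968]
* J. Neukirch, *Algebraic Number Theory*, Springer 1999, Ch. VI §1 (1.7)–(1.8) (congruence subgroups of the idèles).
  [NeukirchANT1999]
* J. Tate, *Global class field theory*, Ch. VII of Cassels–Fröhlich (1967), §5.7 (`J_ℚ ≅ ℚ^* × ℝ_+^* × ∏_p U_p`).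
  [CasselsFrohlichANT1967]

## Provenance

Lane `lit-hodgefound`, seat `literature-prover-lit-hodgefound-skel-3-g26-0` (row A3-G40, FILE 1 of 2).
-/

set_option autoImplicit false

noncomputable section

open NumberField IsDedekindDomain IsDedekindDomain.HeightOneSpectrum Field
open scoped RestrictedProduct nonZeroDivisors

namespace Literature.NumberTheory.NumberFields

open Literature.NumberTheory.GaloisRepresentations

/-! ## §1. The local component at a finite place `v` of `ℚ` -/

section Local

variable (v : HeightOneSpectrum (𝓞 ℚ))

attribute [local instance] Rat.fact_prime_natGenerator

/-- `p_v ∤ n ⇒ |n|_v = 1` (on `ℚ_v`, for natural numbers; the trunk's `Rat.valuation_intCast_eq_one`). [folklore] -/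
private theorem valued_natCast_eq_one_of_not_dvd {n : ℕ} (hn : ¬ Rat.HeightOneSpectrum.natGenerator v ∣ n) :
    Valued.v ((n : ℕ) : v.adicCompletion ℚ) = 1 := by
  rw [Rat.valued_natCast, Rat.valuation_natCast, intValuation_eq_one_iff, Rat.natCast_mem_asIdeal_iff]
  exact hn

/-- Mathlib's `e_v : 𝒪_v ≃A[ℤ] ℤ_[p_v]` (`Rat.HeightOneSpectrum.adicCompletionIntegers.padicIntEquiv`: the valuation ring of
the completion `ℚ_v` is `ℤ_{p_v} = lim ℤ/p_v^n`) as a ring isomorphism, with the index written `p_v = natGenerator v`.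
[cite: NeukirchANT1999, Ch. II §2 Prop. (2.1), §4 Prop. (4.5)] -/
def padicIntRingEquiv : v.adicCompletionIntegers ℚ ≃+* ℤ_[Rat.HeightOneSpectrum.natGenerator v] :=
  (Rat.HeightOneSpectrum.adicCompletionIntegers.padicIntEquiv (R := 𝓞 ℚ) v).toRingEquiv

/-- `e_v` is Mathlib's `padicIntEquiv`. [cite: NeukirchANT1999, Ch. II §4 Prop. (4.5)] -/
theorem padicIntRingEquiv_apply (x : v.adicCompletionIntegers ℚ) :
    padicIntRingEquiv v x = Rat.HeightOneSpectrum.adicCompletionIntegers.padicIntEquiv (R := 𝓞 ℚ) v x := rfl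

/-- **The local component `χ_v : Γ_ℚ →* 𝒪_v^×` of the cyclotomic character**: the `p_v`-adic cyclotomic character
`GaloisRep.cyclotomicCharacter ℚ p_v : Γ_ℚ →ₜ* ℤ_[p_v]ˣ` (Mathlib's `cyclotomicCharacter (AlgebraicClosure ℚ) p_v`,
`σ • t = t ^ (χ_p(σ) mod p^k)` on `μ_{p^k}`) transported to the units of `𝒪_v = ℤ_{p_v}` along Mathlib's
`padicIntEquiv v : 𝒪_v ≃A[ℤ] ℤ_[p_v]`. [cite: MilneCM2006, Ch. II §9, p. 76 (definition of χ_cyc)]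
[cite: SerreAbelianLadic1968, Ch. I §1.2] -/
def cyclotomicLocalUnit : absoluteGaloisGroup ℚ →* (v.adicCompletionIntegers ℚ)ˣ :=
  (Units.map ((padicIntRingEquiv v).symm : ℤ_[Rat.HeightOneSpectrum.natGenerator v] →* v.adicCompletionIntegers ℚ)).comp
    (GaloisRep.cyclotomicCharacter ℚ (Rat.HeightOneSpectrum.natGenerator v)).toMonoidHom

/-- Unfolding: `χ_v(σ) = e_v⁻¹ (χ_{p_v}(σ))`. [cite: MilneCM2006, Ch. II §9, p. 76] -/
theorem coe_cyclotomicLocalUnit (σ : absoluteGaloisGroup ℚ) :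
    (cyclotomicLocalUnit v σ : v.adicCompletionIntegers ℚ) =
      (padicIntRingEquiv v).symm
        (GaloisRep.cyclotomicCharacter ℚ (Rat.HeightOneSpectrum.natGenerator v) σ :
          ℤ_[Rat.HeightOneSpectrum.natGenerator v]) := rfl

/-- And back: `e_v (χ_v(σ)) = χ_{p_v}(σ)`. [cite: MilneCM2006, Ch. II §9, p. 76] -/
theorem padicIntRingEquiv_coe_cyclotomicLocalUnit (σ : absoluteGaloisGroup ℚ) :
    padicIntRingEquiv v (cyclotomicLocalUnit v σ : v.adicCompletionIntegers ℚ) =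
      (GaloisRep.cyclotomicCharacter ℚ (Rat.HeightOneSpectrum.natGenerator v) σ :
        ℤ_[Rat.HeightOneSpectrum.natGenerator v]) := by
  rw [coe_cyclotomicLocalUnit, RingEquiv.apply_symm_apply]

/-- `|χ_v(σ)|_v = 1` (a unit of `𝒪_v`). [cite: MilneCM2006, Ch. II §9, p. 76 («χ_cyc : Gal(ℚ^al/ℚ) → Ẑ^×»)] -/
theorem valued_coe_cyclotomicLocalUnit (σ : absoluteGaloisGroup ℚ) :
    Valued.v ((cyclotomicLocalUnit v σ : v.adicCompletionIntegers ℚ) : v.adicCompletion ℚ) = 1 :=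
  adicCompletionIntegers.isUnit_iff_valued_eq_one.mp (cyclotomicLocalUnit v σ).isUnit

/-- In `ℚ_[p_v]` (the trunk's `Rat.toPadic v : ℚ_v ≃+* ℚ_[p_v]`): `χ_v(σ) ↦ χ_{p_v}(σ)`. [cite: MilneCM2006, Ch. II §9, p. 76] -/
theorem toPadic_coe_cyclotomicLocalUnit (σ : absoluteGaloisGroup ℚ) :
    Rat.toPadic v ((cyclotomicLocalUnit v σ : v.adicCompletionIntegers ℚ) : v.adicCompletion ℚ) =
      ((GaloisRep.cyclotomicCharacter ℚ (Rat.HeightOneSpectrum.natGenerator v) σ :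
        ℤ_[Rat.HeightOneSpectrum.natGenerator v]) : ℚ_[Rat.HeightOneSpectrum.natGenerator v]) := by
  rw [coe_cyclotomicLocalUnit]
  set z : ℤ_[Rat.HeightOneSpectrum.natGenerator v] :=
    (GaloisRep.cyclotomicCharacter ℚ (Rat.HeightOneSpectrum.natGenerator v) σ : ℤ_[Rat.HeightOneSpectrum.natGenerator v])
  have h1 : (((padicIntRingEquiv v).symm z : v.adicCompletionIntegers ℚ) : v.adicCompletion ℚ) =
      (Rat.toPadic v).symm (z : ℚ_[Rat.HeightOneSpectrum.natGenerator v]) :=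
    Rat.HeightOneSpectrum.adicCompletionIntegers.coe_padicIntEquiv_symm_apply (R := 𝓞 ℚ) v z
  rw [h1]
  exact RingEquiv.apply_symm_apply _ _

/-! ### The dictionary `(p_v^k ∣ χ_v(σ) - n) ↔ (σ • t = t^n on μ_{p_v^k})` -/

/-- **`χ_p(σ) mod p^k = n` iff `σ • t = t^n` for every `t ∈ ℚ̄` with `t^{p^k} = 1`** (Mathlib's
`cyclotomicCharacter.spec` / `modularCyclotomicCharacter.unique` for the trunk's `GaloisRep.cyclotomicCharacter`).
[cite: SerreAbelianLadic1968, Ch. I §1.2] [cite: MilneCM2006, Ch. II §9, p. 76 («σζ = ζ^{χ_cyc(σ)}»)] -/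
theorem toZModPow_cyclotomicCharacter_eq_natCast_iff (p : ℕ) [Fact p.Prime] (k n : ℕ) (σ : absoluteGaloisGroup ℚ) :
    PadicInt.toZModPow k (GaloisRep.cyclotomicCharacter ℚ p σ : ℤ_[p]) = (n : ZMod (p ^ k)) ↔
      ∀ t : AlgebraicClosure ℚ, t ^ p ^ k = 1 → σ • t = t ^ n := by
  constructor
  · intro h t ht
    rw [GaloisRep.cyclotomicCharacter_spec ℚ p σ t ht, h, ZMod.val_natCast, ← pow_eq_pow_mod _ ht]
  · intro h
    rw [GaloisRep.cyclotomicCharacter_apply, cyclotomicCharacter.toZModPow]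
    refine (modularCyclotomicCharacter.unique (AlgebraicClosure ℚ)
      (HasEnoughRootsOfUnity.natCard_rootsOfUnity (AlgebraicClosure ℚ) (p ^ k)) _ fun t ht => ?_).symm
    have ht' : ((t : (AlgebraicClosure ℚ)ˣ) : AlgebraicClosure ℚ) ^ p ^ k = 1 := by
      rw [← Units.val_pow_eq_pow_val, (mem_rootsOfUnity _ t).mp ht, Units.val_one]
    rw [MulSemiringAction.toRingAut_apply, MulSemiringAction.toRingEquiv_apply_apply, h _ ht', ZMod.val_natCast,
      ← pow_eq_pow_mod _ ht']

/-- In `ℤ_[p]`: `p^k ∣ x - n ↔ (x mod p^k) = n` (`ker (ℤ_p → ℤ/p^k) = p^k ℤ_p`, Mathlib `PadicInt.ker_toZModPow`).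
[cite: NeukirchANT1999, Ch. II §1 Prop. (1.2) and §4 Prop. (4.5) (`ℤ_p = lim ℤ/p^n`)] -/
theorem PadicInt.pow_dvd_sub_natCast_iff_toZModPow_eq (p : ℕ) [Fact p.Prime] (k n : ℕ) (x : ℤ_[p]) :
    (p : ℤ_[p]) ^ k ∣ x - n ↔ PadicInt.toZModPow k x = (n : ZMod (p ^ k)) := by
  rw [← Ideal.mem_span_singleton, ← PadicInt.ker_toZModPow, RingHom.mem_ker, map_sub, map_natCast, sub_eq_zero]

/-- **`p_v^k ∣ χ_v(σ) - n` in `𝒪_v` iff `σ • t = t^n` for every `t ∈ ℚ̄` with `t^{p_v^k} = 1`** — the defining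
property of the cyclotomic character read in `𝒪_v = ℤ_{p_v}` (transport along the ring isomorphism `e_v`).
[cite: MilneCM2006, Ch. II §9, p. 76 («σζ = ζ^{χ_cyc(σ)}»)] [cite: SerreAbelianLadic1968, Ch. I §1.2] -/
theorem pow_dvd_cyclotomicLocalUnit_sub_natCast_iff (k n : ℕ) (σ : absoluteGaloisGroup ℚ) :
    (Rat.HeightOneSpectrum.natGenerator v : v.adicCompletionIntegers ℚ) ^ k ∣
        (cyclotomicLocalUnit v σ : v.adicCompletionIntegers ℚ) - n ↔
      ∀ t : AlgebraicClosure ℚ, t ^ Rat.HeightOneSpectrum.natGenerator v ^ k = 1 → σ • t = t ^ n := by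
  rw [← toZModPow_cyclotomicCharacter_eq_natCast_iff, ← PadicInt.pow_dvd_sub_natCast_iff_toZModPow_eq,
    ← map_dvd_iff (padicIntRingEquiv v), map_pow, map_natCast, map_sub, map_natCast,
    padicIntRingEquiv_coe_cyclotomicLocalUnit]

/-- The same in valuation form: **`|χ_v(σ) - n|_v ≤ |p_v|^k ↔ σ • t = t^n` on `μ_{p_v^k}(ℚ̄)`**.
[cite: MilneCM2006, Ch. II §9, p. 76] [cite: NeukirchANT1999, Ch. VI §1 (1.7) («U_𝔭^{(n)} = 1 + 𝔭^n»)] -/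
theorem valued_cyclotomicLocalUnit_sub_natCast_le_iff (k n : ℕ) (σ : absoluteGaloisGroup ℚ) :
    Valued.v (((cyclotomicLocalUnit v σ : v.adicCompletionIntegers ℚ) : v.adicCompletion ℚ) - n) ≤
        WithZero.exp (-(k : ℤ)) ↔
      ∀ t : AlgebraicClosure ℚ, t ^ Rat.HeightOneSpectrum.natGenerator v ^ k = 1 → σ • t = t ^ n := by
  rw [← pow_dvd_cyclotomicLocalUnit_sub_natCast_iff,
    ← Valuation.Integers.le_iff_dvd (adicCompletionIntegers.integers ℚ v)]
  have e1 : (algebraMap (v.adicCompletionIntegers ℚ) (v.adicCompletion ℚ))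
      ((cyclotomicLocalUnit v σ : v.adicCompletionIntegers ℚ) - n) =
      ((cyclotomicLocalUnit v σ : v.adicCompletionIntegers ℚ) : v.adicCompletion ℚ) - n := by
    rw [map_sub, map_natCast]; rfl
  have e2 : Valued.v ((algebraMap (v.adicCompletionIntegers ℚ) (v.adicCompletion ℚ))
      ((Rat.HeightOneSpectrum.natGenerator v : v.adicCompletionIntegers ℚ) ^ k)) = WithZero.exp (-(k : ℤ)) := by
    rw [map_pow, map_natCast, map_pow, Rat.valued_natGenerator, ← WithZero.exp_nsmul, nsmul_eq_mul, mul_neg, mul_one]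
  rw [e1, e2]

end Local

/-! ## §2. The object: `χ_cyc : Γ_ℚ →* (𝔸_{ℚ,f})^×`, with values in `Ẑ^×` -/

section Global

attribute [local instance] Rat.fact_prime_natGenerator

/-- The finite adèle `(χ_v(σ))_v` — every component integral — as a multiplicative map `Γ_ℚ →* 𝔸_{ℚ,f}`
(auxiliary; the idèle is `cyclotomicFiniteIdele`). [cite: MilneCM2006, Ch. II §9, p. 76] -/
def cyclotomicFiniteAdeleHom : absoluteGaloisGroup ℚ →* FiniteAdeleRing (𝓞 ℚ) ℚ where
  toFun σ := RestrictedProduct.structureMap _ _ _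
    (fun v : HeightOneSpectrum (𝓞 ℚ) => (cyclotomicLocalUnit v σ : v.adicCompletionIntegers ℚ))
  map_one' := FiniteAdeleRing.ext ℚ fun v =>
    show ((cyclotomicLocalUnit v 1 : v.adicCompletionIntegers ℚ) : v.adicCompletion ℚ) = 1 by
      rw [map_one, Units.val_one, OneMemClass.coe_one]
  map_mul' σ τ := FiniteAdeleRing.ext ℚ fun v =>
    show ((cyclotomicLocalUnit v (σ * τ) : v.adicCompletionIntegers ℚ) : v.adicCompletion ℚ) =
        ((cyclotomicLocalUnit v σ : v.adicCompletionIntegers ℚ) : v.adicCompletion ℚ) *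
          ((cyclotomicLocalUnit v τ : v.adicCompletionIntegers ℚ) : v.adicCompletion ℚ) by
      rw [map_mul, Units.val_mul, MulMemClass.coe_mul]

/-- **The cyclotomic character as a finite idèle of `ℚ`**, `χ_cyc : Gal(ℚ^al/ℚ) →* 𝔸^×_{ℚ,f}`, `σ ↦ (χ_p(σ))_p ∈
∏_p ℤ_p^× = Ẑ^×`: «`σζ = ζ^{χ_cyc(σ)}` for all roots `ζ` of `1`» (the defining property at every level `N` is
`principalIdele_inv_mul_cyclotomicIdele_mem_congruenceIdeles` / `cyclotomicFiniteIdele_mem_congruenceUnits_iff` below;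
uniqueness `eq_cyclotomicFiniteIdele_of_forall`). [cite: MilneCM2006, Ch. II §9, p. 76 (before Lemma 9.4)] -/
def cyclotomicFiniteIdele : absoluteGaloisGroup ℚ →* (FiniteAdeleRing (𝓞 ℚ) ℚ)ˣ :=
  cyclotomicFiniteAdeleHom.toHomUnits

/-- **Components: `χ_cyc(σ)_v = χ_v(σ) = e_v⁻¹(χ_{p_v}(σ))`.** [cite: MilneCM2006, Ch. II §9, p. 76] -/
@[simp] theorem coe_cyclotomicFiniteIdele_apply (σ : absoluteGaloisGroup ℚ) (v : HeightOneSpectrum (𝓞 ℚ)) :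
    (cyclotomicFiniteIdele σ : FiniteAdeleRing (𝓞 ℚ) ℚ) v =
      ((cyclotomicLocalUnit v σ : v.adicCompletionIntegers ℚ) : v.adicCompletion ℚ) :=
  RestrictedProduct.structureMap_apply _ _ v

/-- `|χ_cyc(σ)_v|_v = 1` at every `v`. [cite: MilneCM2006, Ch. II §9, p. 76 («χ_cyc : Gal(ℚ^al/ℚ) → Ẑ^×»)] -/
theorem valued_cyclotomicFiniteIdele_apply (σ : absoluteGaloisGroup ℚ) (v : HeightOneSpectrum (𝓞 ℚ)) :
    Valued.v ((cyclotomicFiniteIdele σ : FiniteAdeleRing (𝓞 ℚ) ℚ) v) = 1 := by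
  rw [coe_cyclotomicFiniteIdele_apply, valued_coe_cyclotomicLocalUnit]

/-- **`χ_cyc(σ) ∈ Ẑ^×`**: `ord_v χ_cyc(σ) = 0` at every finite place, i.e. `χ_cyc(σ)` lies in the unit finite idèles
`ker (𝔸^×_{ℚ,f} → I_ℚ)`. [cite: MilneCM2006, Ch. II §9, p. 76 («χ_cyc : Gal(ℚ^al/ℚ) → Ẑ^×»)] -/
theorem cyclotomicFiniteIdele_mem_ker_toIdealUnits (σ : absoluteGaloisGroup ℚ) :
    cyclotomicFiniteIdele σ ∈ (IdeleIdeal.toIdealUnits (𝓞 ℚ) ℚ).ker :=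
  (IdeleIdeal.mem_ker_toIdealUnits_iff_valued _).mpr fun v => valued_cyclotomicFiniteIdele_apply σ v

/-- `ord_v χ_cyc(σ) = 0`. [cite: MilneCM2006, Ch. II §9, p. 76] -/
theorem unitOrd_cyclotomicFiniteIdele (σ : absoluteGaloisGroup ℚ) (v : HeightOneSpectrum (𝓞 ℚ)) :
    Automorphic.FiniteAdeleRing.unitOrd (𝓞 ℚ) ℚ (cyclotomicFiniteIdele σ) v = 0 :=
  (Automorphic.FiniteAdeleRing.unitOrd_eq_zero_iff _ v).mpr (valued_cyclotomicFiniteIdele_apply σ v)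

/-- **The idèle `(1, χ_cyc(σ)) ∈ 𝕀_ℚ`** (archimedean component `1`): `χ_cyc(σ)` regarded in the full idèle group, the
form in which `[·, ℚ]` is applied to it. [cite: MilneCM2006, Ch. II §9, Lemma 9.4] -/
def cyclotomicIdele : absoluteGaloisGroup ℚ →* ideleGroup ℚ :=
  (Units.map (N := AdeleRing (𝓞 ℚ) ℚ) (MonoidHom.inr (InfiniteAdeleRing ℚ) (FiniteAdeleRing (𝓞 ℚ) ℚ))).comp
    cyclotomicFiniteIdele

/-- Unfolding: `cyclotomicIdele σ = (1, χ_cyc σ)`. [cite: MilneCM2006, Ch. II §9, Lemma 9.4] -/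
theorem cyclotomicIdele_apply (σ : absoluteGaloisGroup ℚ) :
    cyclotomicIdele σ = Units.map (N := AdeleRing (𝓞 ℚ) ℚ)
      (MonoidHom.inr (InfiniteAdeleRing ℚ) (FiniteAdeleRing (𝓞 ℚ) ℚ)) (cyclotomicFiniteIdele σ) := rfl

/-- Finite components of `(1, χ_cyc σ)`. [cite: MilneCM2006, Ch. II §9, Lemma 9.4] -/
@[simp] theorem cyclotomicIdele_snd (σ : absoluteGaloisGroup ℚ) (v : HeightOneSpectrum (𝓞 ℚ)) :
    ((cyclotomicIdele σ : ideleGroup ℚ) : AdeleRing (𝓞 ℚ) ℚ).2 v =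
      ((cyclotomicLocalUnit v σ : v.adicCompletionIntegers ℚ) : v.adicCompletion ℚ) :=
  coe_cyclotomicFiniteIdele_apply σ v

/-- The archimedean component of `(1, χ_cyc σ)` is `1`. [cite: MilneCM2006, Ch. II §9, Lemma 9.4] -/
@[simp] theorem cyclotomicIdele_fst (σ : absoluteGaloisGroup ℚ) :
    ((cyclotomicIdele σ : ideleGroup ℚ) : AdeleRing (𝓞 ℚ) ℚ).1 = 1 := rfl

/-- The finite part of `(1, χ_cyc σ)` is `χ_cyc σ`. [cite: MilneCM2006, Ch. II §9, Lemma 9.4] -/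
@[simp] theorem finitePart_cyclotomicIdele (σ : absoluteGaloisGroup ℚ) :
    IdeleAction.finitePart ℚ (cyclotomicIdele σ) = cyclotomicFiniteIdele σ :=
  Units.ext rfl

/-- **`(1, χ_cyc σ)` is a unit idèle** (`∈ ∏_p ℤ_p^× × ℝ^×`). [cite: MilneCM2006, Ch. II §9, p. 76]
[cite: CasselsFrohlichANT1967, Ch. VII §5.7 («J_ℚ ≅ ℚ^* × ℝ_+^* × ∏_p U_p»)] -/
theorem cyclotomicIdele_mem_unitIdeles (σ : absoluteGaloisGroup ℚ) : cyclotomicIdele σ ∈ unitIdeles ℚ :=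
  fun v => by rw [cyclotomicIdele_snd, valued_coe_cyclotomicLocalUnit]

/-! ### `χ_cyc(σ)` in the trunk's coordinates on `𝕀_ℚ` (`Rat.padicUnitPart`, `Rat.localRed`, `Rat.redMod`,
`Rat.rayClassHom` of `GaloisRepresentations/HeckeCharacterProofs`: Tate's `J_ℚ = ℚ^* × ℝ_+^* × ∏_p U_p`) -/

/-- **The `p`-component of `χ_cyc(σ)` is `χ_p(σ)`**: the trunk's unit part `𝕀_ℚ → ℤ_[p_v]ˣ` of `(1, χ_cyc σ)` at `v`
is the `p_v`-adic cyclotomic character. [cite: MilneCM2006, Ch. II §9, p. 76] [cite: SerreAbelianLadic1968, Ch. I §1.2] -/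
theorem padicUnitPart_cyclotomicIdele (v : HeightOneSpectrum (𝓞 ℚ)) (σ : absoluteGaloisGroup ℚ) :
    Rat.padicUnitPart v (cyclotomicIdele σ) =
      GaloisRep.cyclotomicCharacter ℚ (Rat.HeightOneSpectrum.natGenerator v) σ := by
  refine Units.ext (PadicInt.ext ?_)
  rw [Rat.coe_padicUnitPart_of_valued_eq_one v _
      (by rw [cyclotomicIdele_snd]; exact valued_coe_cyclotomicLocalUnit v σ),
    Rat.padicComp_apply, cyclotomicIdele_snd, toPadic_coe_cyclotomicLocalUnit]

/-- `χ_cyc(σ) mod p_v^k = χ_{p_v}(σ) mod p_v^k` (the trunk's local reduction `Rat.localRed v k : 𝕀_ℚ → (ℤ/p_v^k)ˣ`).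
[cite: MilneCM2006, Ch. II §9, p. 76] -/
theorem val_localRed_cyclotomicIdele (v : HeightOneSpectrum (𝓞 ℚ)) (k : ℕ) (σ : absoluteGaloisGroup ℚ) :
    (Rat.localRed v k (cyclotomicIdele σ) : ZMod (Rat.HeightOneSpectrum.natGenerator v ^ k)) =
      PadicInt.toZModPow k
        (GaloisRep.cyclotomicCharacter ℚ (Rat.HeightOneSpectrum.natGenerator v) σ :
          ℤ_[Rat.HeightOneSpectrum.natGenerator v]) := by
  rw [Rat.val_localRed, padicUnitPart_cyclotomicIdele]

/-- **«`σζ = ζ^{χ_cyc(σ)}` for all roots `ζ` of `1`»: `χ_cyc(σ) mod N = χ_N(σ)` for every `N ≥ 1`** — the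
reduction mod `N` (the trunk's `Rat.redMod N : 𝕀_ℚ → (ℤ/N)ˣ`, CRT over the `p^e ‖ N`) of `(1, χ_cyc σ)` IS the
mod-`N` cyclotomic character `modNCyclotomicCharacter ℚ N σ` (`σ • t = t^{χ_N(σ)}` on `μ_N(ℚ̄)`).  This is the
printed definition of `χ_cyc : Gal(ℚ^al/ℚ) → Ẑ^× = lim (ℤ/N)^×`. [cite: MilneCM2006, Ch. II §9, p. 76 (definition of χ_cyc)] -/
theorem redMod_cyclotomicIdele (N : ℕ) [NeZero N] (σ : absoluteGaloisGroup ℚ) :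
    Rat.redMod N (cyclotomicIdele σ) = modNCyclotomicCharacter ℚ N σ := by
  refine Units.ext ((ZMod.equivPi (n := N) (NeZero.ne N)).injective (funext fun q => ?_))
  set m : ℕ := (modNCyclotomicCharacter ℚ N σ : ZMod N).val with hm
  have hχ : ((modNCyclotomicCharacter ℚ N σ : (ZMod N)ˣ) : ZMod N) = (m : ZMod N) :=
    (ZMod.natCast_zmod_val _).symm
  have hv : ∀ t : AlgebraicClosure ℚ,
      t ^ Rat.HeightOneSpectrum.natGenerator (Rat.placeOfFactor N q) ^ N.factorization q = 1 → σ • t = t ^ m :=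
    fun t ht => modNCyclotomicCharacter_spec ℚ N σ t (by
      obtain ⟨c, hc⟩ : Rat.HeightOneSpectrum.natGenerator (Rat.placeOfFactor N q) ^ N.factorization q ∣ N := by
        rw [Rat.natGenerator_placeOfFactor_pow]; exact Nat.ordProj_dvd N q
      rw [hc, pow_mul, ht, one_pow])
  rw [hχ, map_natCast, Pi.natCast_apply, Rat.equivPi_redMod, Rat.val_localRedFactor, val_localRed_cyclotomicIdele,
    (toZModPow_cyclotomicCharacter_eq_natCast_iff _ _ m σ).mpr hv, map_natCast]

/-- The archimedean coordinate of `(1, χ_cyc σ)` is `1` (the trunk's `Rat.infReal : 𝕀_ℚ → ℝ`). [cite: MilneCM2006, Ch. II §9, Lemma 9.4] -/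
theorem infReal_cyclotomicIdele (σ : absoluteGaloisGroup ℚ) : Rat.infReal (cyclotomicIdele σ) = 1 := by
  rw [Rat.infReal_apply, show ((cyclotomicIdele σ : ideleGroup ℚ) : AdeleRing (𝓞 ℚ) ℚ).1 Rat.infinitePlace = 1
    from rfl, map_one]

/-- **The same for the trunk's ray class map `Rat.rayClassHom N : 𝕀_ℚ → 𝕀_ℚ/(ℚ^× ℝ_{>0} I^{(N)}) ≅ (ℤ/N)ˣ`**
(`(1, χ_cyc σ)` already lies in `ℝ_{>0} × Ẑ^×`): the ray class of `χ_cyc(σ)` mod `N` is `χ_N(σ)`.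
[cite: MilneCM2006, Ch. II §9, p. 76] [cite: NeukirchANT1999, Ch. VI Prop. (1.10)] -/
theorem rayClassHom_cyclotomicIdele (N : ℕ) [NeZero N] (σ : absoluteGaloisGroup ℚ) :
    Rat.rayClassHom N (cyclotomicIdele σ) = modNCyclotomicCharacter ℚ N σ := by
  rw [Rat.rayClassHom_eq_redMod N _ (by rw [infReal_cyclotomicIdele]; exact one_pos) (cyclotomicIdele_mem_unitIdeles σ),
    redMod_cyclotomicIdele]

end Global

/-! ## §3. The defining property at level `N`: «`σζ = ζ^{χ_cyc(σ) mod N}` for all `ζ ∈ μ_N(ℚ̄)`» -/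

section Level

attribute [local instance] Rat.fact_prime_natGenerator

variable (v : HeightOneSpectrum (𝓞 ℚ))

/-- `𝔭_v^e ∣ (N)` in `𝓞 ℚ` means `p_v^e ∣ N` in `ℕ`. [folklore] -/
private theorem natGenerator_pow_dvd_of_asIdeal_pow_dvd {e N : ℕ} (h : v.asIdeal ^ e ∣ Ideal.span {(N : 𝓞 ℚ)}) :
    Rat.HeightOneSpectrum.natGenerator v ^ e ∣ N := by
  rw [Rat.asIdeal_eq_span_natGenerator, Ideal.span_singleton_pow, Ideal.dvd_iff_le,
    Ideal.span_singleton_le_span_singleton] at h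
  have h' := map_dvd (Rat.ringOfIntegersEquiv : 𝓞 ℚ →+* ℤ) h
  rw [map_pow, map_natCast, map_natCast, ← Nat.cast_pow] at h'
  exact Int.natCast_dvd_natCast.mp h'

/-- `p_v^{n_v((N))} ∣ N` for the multiplicity `n_v = modulusExp (N) v` of `𝔭_v` in `(N)` (Neukirch's exponent `n_𝔭` of the
module `𝔪 = ∏ 𝔭^{n_𝔭}`). [cite: NeukirchANT1999, Ch. VI §1 Def. (1.7) p. 363] -/
theorem natGenerator_pow_modulusExp_dvd (N : ℕ) :
    Rat.HeightOneSpectrum.natGenerator v ^ modulusExp (Ideal.span {(N : 𝓞 ℚ)}) v ∣ N :=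
  natGenerator_pow_dvd_of_asIdeal_pow_dvd v (pow_modulusExp_dvd v)

/-- `n_v((N)) ≠ 0 ⇒ p_v ∣ N`. [cite: NeukirchANT1999, Ch. VI §1 Def. (1.7) p. 363] -/
theorem natGenerator_dvd_of_modulusExp_ne_zero {N : ℕ} (hv : modulusExp (Ideal.span {(N : 𝓞 ℚ)}) v ≠ 0) :
    Rat.HeightOneSpectrum.natGenerator v ∣ N :=
  (dvd_pow_self _ hv).trans (natGenerator_pow_modulusExp_dvd v N)

/-- `p_v^k ∣ N ≠ 0 ⇒ k ≤ n_v((N))`. [cite: NeukirchANT1999, Ch. VI §1 Def. (1.7) p. 363] -/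
theorem le_modulusExp_of_natGenerator_pow_dvd {N k : ℕ} (hN : N ≠ 0) (h : Rat.HeightOneSpectrum.natGenerator v ^ k ∣ N) :
    k ≤ modulusExp (Ideal.span {(N : 𝓞 ℚ)}) v := by
  have hI : v.asIdeal ^ k ∣ Ideal.span {(N : 𝓞 ℚ)} := by
    rw [Rat.asIdeal_eq_span_natGenerator, Ideal.span_singleton_pow, Ideal.dvd_iff_le,
      Ideal.span_singleton_le_span_singleton, ← Nat.cast_pow]
    exact Nat.cast_dvd_cast h
  have hN' : Associates.mk (Ideal.span {(N : 𝓞 ℚ)}) ≠ 0 := by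
    rw [Ne, Associates.mk_eq_zero, Ideal.zero_eq_bot, Ideal.span_singleton_eq_bot]
    exact_mod_cast hN
  rw [modulusExp, ← Associates.prime_pow_dvd_iff_le hN' v.associates_irreducible, ← Associates.mk_pow,
    Associates.mk_le_mk_iff_dvd]
  exact hI

/-- `gcd(n, N) = 1` and `p_v ∣ N` give `p_v ∤ n`. [folklore] -/
private theorem not_natGenerator_dvd_of_coprime {N n : ℕ} (hn : n.Coprime N) (hv : Rat.HeightOneSpectrum.natGenerator v ∣ N) :
    ¬ Rat.HeightOneSpectrum.natGenerator v ∣ n := fun hpn =>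
  (Rat.HeightOneSpectrum.prime_natGenerator v).ne_one (Nat.eq_one_of_dvd_coprimes hn hpn hv)

/-- The `v`-component of `(n)⁻¹ · (1, χ_cyc σ)` minus `1` has valuation `|χ_v(σ) - n|_v` when `p_v ∤ n`.
[cite: MilneCM2006, Ch. II §9, p. 76] -/
theorem valued_snd_principalIdele_inv_mul_cyclotomicIdele_sub_one {n : ℕ} (hn0 : (n : ℚ) ≠ 0)
    (hpn : ¬ Rat.HeightOneSpectrum.natGenerator v ∣ n) (σ : absoluteGaloisGroup ℚ) :
    Valued.v (((principalIdele ℚ (Units.mk0 (n : ℚ) hn0)⁻¹ * cyclotomicIdele σ : ideleGroup ℚ) :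
        AdeleRing (𝓞 ℚ) ℚ).2 v - 1) =
      Valued.v (((cyclotomicLocalUnit v σ : v.adicCompletionIntegers ℚ) : v.adicCompletion ℚ) - n) := by
  have hnv : Valued.v ((n : ℕ) : v.adicCompletion ℚ) = 1 := valued_natCast_eq_one_of_not_dvd v hpn
  have hn0' : ((n : ℕ) : v.adicCompletion ℚ) ≠ 0 := fun h0 => by
    rw [h0, map_zero] at hnv
    exact zero_ne_one hnv
  rw [ideleGroup_val_snd_mul, cyclotomicIdele_snd, principalIdele_snd, Units.val_inv_eq_inv_val, Units.val_mk0,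
    map_inv₀, map_natCast,
    show ((n : ℕ) : v.adicCompletion ℚ)⁻¹ *
        ((cyclotomicLocalUnit v σ : v.adicCompletionIntegers ℚ) : v.adicCompletion ℚ) - 1 =
      ((n : ℕ) : v.adicCompletion ℚ)⁻¹ *
        (((cyclotomicLocalUnit v σ : v.adicCompletionIntegers ℚ) : v.adicCompletion ℚ) - n) by
      rw [mul_sub, inv_mul_cancel₀ hn0'],
    map_mul, map_inv₀, hnv, inv_one, one_mul]

/-- The archimedean component of `(a) · (1, χ_cyc σ)` at the real place of `ℚ` is `a`. [cite: MilneCM2006, Ch. II §9, Lemma 9.4] -/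
theorem extensionEmbeddingOfIsReal_fst_principalIdele_mul_cyclotomicIdele (a : ℚˣ) (σ : absoluteGaloisGroup ℚ)
    (w : InfinitePlace ℚ) (hw : w.IsReal) :
    InfinitePlace.Completion.extensionEmbeddingOfIsReal hw
        (((principalIdele ℚ a * cyclotomicIdele σ : ideleGroup ℚ) : AdeleRing (𝓞 ℚ) ℚ).1 w) =
      InfinitePlace.embedding_of_isReal hw (a : ℚ) := by
  rw [ideleGroup_val_fst_mul, principalIdele_fst, cyclotomicIdele_fst, mul_one, InfiniteAdeleRing.algebraMap_apply]
  exact InfinitePlace.Completion.extensionEmbeddingOfIsReal_coe hw (WithAbs.toAbs w.1 (a : ℚ))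

/-- **THE DEFINING PROPERTY OF `χ_cyc` AT LEVEL `N`, congruence form: «`χ_cyc(σ) ≡ n mod^× N`».**  If
`σ • t = t^n` for every `t ∈ ℚ̄` with `t^N = 1` (`gcd(n, N) = 1`), then the idèle `(n)⁻¹ · (1, χ_cyc σ)` lies in
the congruence subgroup `W_{(N)}` (`χ_cyc(σ)_p ≡ n mod N ℤ_p` for `p ∣ N`, and `n⁻¹ > 0` at `∞`) — the hypothesis
of Tate's «`ζ^{ψ(x)} = ζ^{u^{-1}}`» in the tree (`cycloChar_abRestrict_ideleArtinMap_rat_of_inv_mul_mem`).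
[cite: MilneCM2006, Ch. II §9, p. 76 («σζ = ζ^{χ_cyc(σ)} for all roots ζ of 1»)]
[cite: CasselsFrohlichANT1967, Ch. VII §5.7 (PDF p. 214)] -/
theorem principalIdele_inv_mul_cyclotomicIdele_mem_congruenceIdeles {N n : ℕ} (hn0 : (n : ℚ) ≠ 0)
    (hn : n.Coprime N) {σ : absoluteGaloisGroup ℚ} (h : ∀ t : AlgebraicClosure ℚ, t ^ N = 1 → σ • t = t ^ n) :
    principalIdele ℚ (Units.mk0 (n : ℚ) hn0)⁻¹ * cyclotomicIdele σ ∈ congruenceIdeles (Ideal.span {(N : 𝓞 ℚ)}) := by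
  rw [mem_congruenceIdeles_iff]
  refine ⟨fun v hv => ?_, fun w hw => ?_⟩
  · set e := modulusExp (Ideal.span {(N : 𝓞 ℚ)}) v with he
    have hdvd : Rat.HeightOneSpectrum.natGenerator v ^ e ∣ N := natGenerator_pow_modulusExp_dvd v N
    rw [valued_snd_principalIdele_inv_mul_cyclotomicIdele_sub_one v hn0
      (not_natGenerator_dvd_of_coprime v hn (natGenerator_dvd_of_modulusExp_ne_zero v hv)) σ]
    exact (valued_cyclotomicLocalUnit_sub_natCast_le_iff v e n σ).mpr fun t ht =>
      h t (by obtain ⟨c, hc⟩ := hdvd; rw [hc, pow_mul, ht, one_pow])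
  · have hpos : (0 : ℝ) < ((n : ℚ) : ℝ)⁻¹ :=
      inv_pos.mpr (by exact_mod_cast Nat.pos_of_ne_zero (fun h0 => hn0 (by rw [h0, Nat.cast_zero])))
    rw [extensionEmbeddingOfIsReal_fst_principalIdele_mul_cyclotomicIdele, Units.val_inv_eq_inv_val, Units.val_mk0,
      map_inv₀, map_natCast]
    rw [Rat.cast_natCast] at hpos
    exact hpos

/-- **Existence form at every level `N ≥ 1`**: there is `n ≥ 1` prime to `N` with `σ • t = t^n` on `μ_N(ℚ̄)` (namely
`n ≡ χ_N(σ)`, the tree's `modNCyclotomicCharacter ℚ N σ`) and `(n)⁻¹ · (1, χ_cyc σ) ∈ W_{(N)}` — «`χ_cyc(σ) mod N` is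
the exponent through which `σ` acts on `μ_N`». [cite: MilneCM2006, Ch. II §9, p. 76 («σζ = ζ^{χ_cyc(σ)}»)] -/
theorem exists_principalIdele_inv_mul_cyclotomicIdele_mem_congruenceIdeles (N : ℕ) [NeZero N]
    (σ : absoluteGaloisGroup ℚ) :
    ∃ (n : ℕ) (hn0 : (n : ℚ) ≠ 0), n.Coprime N ∧ (∀ t : AlgebraicClosure ℚ, t ^ N = 1 → σ • t = t ^ n) ∧
      principalIdele ℚ (Units.mk0 (n : ℚ) hn0)⁻¹ * cyclotomicIdele σ ∈ congruenceIdeles (Ideal.span {(N : 𝓞 ℚ)}) := by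
  set m : ℕ := (modNCyclotomicCharacter ℚ N σ : ZMod N).val with hm
  have hmN : (m + N).Coprime N := by
    rw [Nat.coprime_add_self_left]
    exact ZMod.val_coe_unit_coprime (modNCyclotomicCharacter ℚ N σ)
  have h0 : ((m + N : ℕ) : ℚ) ≠ 0 := Nat.cast_ne_zero.mpr (by have := NeZero.ne N; omega)
  have hact : ∀ t : AlgebraicClosure ℚ, t ^ N = 1 → σ • t = t ^ (m + N) := fun t ht => by
    rw [pow_add, ht, mul_one]
    exact modNCyclotomicCharacter_spec ℚ N σ t ht
  exact ⟨m + N, h0, hmN, hact, principalIdele_inv_mul_cyclotomicIdele_mem_congruenceIdeles h0 hmN hact⟩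

/-- **Local converse**: if `(n)⁻¹ · (1, χ_cyc σ) ∈ W_{(N)}` (`gcd(n, N) = 1`) then `σ • t = t^n` on `μ_{p^k}(ℚ̄)`
for every prime power `p^k ∣ N`. [cite: MilneCM2006, Ch. II §9, p. 76] -/
theorem forall_smul_eq_pow_of_mem_congruenceIdeles_of_pow_dvd {N n : ℕ} (hN : N ≠ 0) (hn0 : (n : ℚ) ≠ 0)
    (hn : n.Coprime N) {σ : absoluteGaloisGroup ℚ}
    (h : principalIdele ℚ (Units.mk0 (n : ℚ) hn0)⁻¹ * cyclotomicIdele σ ∈ congruenceIdeles (Ideal.span {(N : 𝓞 ℚ)}))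
    {k : ℕ} (hk : Rat.HeightOneSpectrum.natGenerator v ^ k ∣ N) :
    ∀ t : AlgebraicClosure ℚ, t ^ Rat.HeightOneSpectrum.natGenerator v ^ k = 1 → σ • t = t ^ n := by
  rcases Nat.eq_zero_or_pos k with rfl | hkpos
  · intro t ht
    rw [pow_zero, pow_one] at ht
    rw [ht, smul_one, one_pow]
  have hke : k ≤ modulusExp (Ideal.span {(N : 𝓞 ℚ)}) v := le_modulusExp_of_natGenerator_pow_dvd v hN hk
  have hv : modulusExp (Ideal.span {(N : 𝓞 ℚ)}) v ≠ 0 := by omega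
  have hle := ((mem_congruenceIdeles_iff).mp h).1 v hv
  rw [valued_snd_principalIdele_inv_mul_cyclotomicIdele_sub_one v hn0
    (not_natGenerator_dvd_of_coprime v hn (natGenerator_dvd_of_modulusExp_ne_zero v hv)) σ] at hle
  refine (valued_cyclotomicLocalUnit_sub_natCast_le_iff v k n σ).mp (hle.trans ?_)
  rw [WithZero.exp_le_exp, neg_le_neg_iff, Nat.cast_le]
  exact hke

/-- **THE DEFINING PROPERTY AT LEVEL `N`, converse: «`χ_cyc(σ) ≡ n mod^× N`» forces `σ • t = t^n` on `μ_N(ℚ̄)`**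
— prime power by prime power (`forall_smul_eq_pow_of_mem_congruenceIdeles_of_pow_dvd`) and then for `N` itself by
`N ∣ d ↔ (p^k ∣ N → p^k ∣ d)` (`Nat.dvd_iff_prime_pow_dvd_dvd`), comparing with the exponent `χ_N(σ)`.
[cite: MilneCM2006, Ch. II §9, p. 76 («σζ = ζ^{χ_cyc(σ)} for all roots ζ of 1»)] -/
theorem forall_smul_eq_pow_of_mem_congruenceIdeles {N n : ℕ} [NeZero N] (hn0 : (n : ℚ) ≠ 0) (hn : n.Coprime N)
    {σ : absoluteGaloisGroup ℚ}
    (h : principalIdele ℚ (Units.mk0 (n : ℚ) hn0)⁻¹ * cyclotomicIdele σ ∈ congruenceIdeles (Ideal.span {(N : 𝓞 ℚ)})) :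
    ∀ t : AlgebraicClosure ℚ, t ^ N = 1 → σ • t = t ^ n := by
  obtain ⟨m, hm0, hmN, hact, -⟩ := exists_principalIdele_inv_mul_cyclotomicIdele_mem_congruenceIdeles N σ
  intro t ht
  suffices hmn : m ≡ n [MOD N] by rw [hact t ht, pow_eq_pow_mod m ht, hmn, ← pow_eq_pow_mod n ht]
  -- local-to-global: `N ∣ |n - m|` because every prime power dividing `N` does
  have key : ∀ p k : ℕ, p.Prime → p ^ k ∣ N → p ^ k ∣ ((n : ℤ) - m).natAbs := by
    intro p k hp hpk
    set v : HeightOneSpectrum (𝓞 ℚ) := (Rat.HeightOneSpectrum.primesEquiv (R := 𝓞 ℚ)).symm ⟨p, hp⟩ with hvdef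
    have hvp : Rat.HeightOneSpectrum.natGenerator v = p :=
      congrArg Subtype.val ((Rat.HeightOneSpectrum.primesEquiv (R := 𝓞 ℚ)).apply_symm_apply ⟨p, hp⟩)
    rw [← hvp] at hpk ⊢
    -- on `μ_{p^k}`: `σ • t = t^n` (hypothesis) and `σ • t = t^m` (the exponent `χ_N`)
    have h1 := forall_smul_eq_pow_of_mem_congruenceIdeles_of_pow_dvd v (NeZero.ne N) hn0 hn h hpk
    have h2 : ∀ t : AlgebraicClosure ℚ, t ^ Rat.HeightOneSpectrum.natGenerator v ^ k = 1 → σ • t = t ^ m :=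
      fun t ht => hact t (by obtain ⟨c, hc⟩ := hpk; rw [hc, pow_mul, ht, one_pow])
    rw [← toZModPow_cyclotomicCharacter_eq_natCast_iff] at h1 h2
    have h12 : (n : ZMod (Rat.HeightOneSpectrum.natGenerator v ^ k)) = m := h1.symm.trans h2
    rw [ZMod.natCast_eq_natCast_iff, Nat.modEq_iff_dvd, dvd_sub_comm] at h12
    exact Int.natCast_dvd.mp (by exact_mod_cast h12)
  have hd : N ∣ ((n : ℤ) - m).natAbs := (Nat.dvd_iff_prime_pow_dvd_dvd _ N).mpr key
  exact (Nat.modEq_iff_dvd.mpr (Int.natCast_dvd.mpr hd))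

/-- **THE DEFINING PROPERTY AT LEVEL `N`, as an equivalence**: for `gcd(n, N) = 1`,
`(n)⁻¹ · (1, χ_cyc σ) ∈ W_{(N)} ↔ σ • t = t^n` for all `t ∈ μ_N(ℚ̄)` — «`χ_cyc(σ) ≡ n (mod N)` iff `σζ = ζ^n` for all
`N`-th roots of unity». [cite: MilneCM2006, Ch. II §9, p. 76 («σζ = ζ^{χ_cyc(σ)} for all roots ζ of 1»)] -/
theorem principalIdele_inv_mul_cyclotomicIdele_mem_congruenceIdeles_iff {N n : ℕ} [NeZero N] (hn0 : (n : ℚ) ≠ 0)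
    (hn : n.Coprime N) (σ : absoluteGaloisGroup ℚ) :
    principalIdele ℚ (Units.mk0 (n : ℚ) hn0)⁻¹ * cyclotomicIdele σ ∈ congruenceIdeles (Ideal.span {(N : 𝓞 ℚ)}) ↔
      ∀ t : AlgebraicClosure ℚ, t ^ N = 1 → σ • t = t ^ n :=
  ⟨forall_smul_eq_pow_of_mem_congruenceIdeles hn0 hn, principalIdele_inv_mul_cyclotomicIdele_mem_congruenceIdeles hn0 hn⟩

/-- Mathlib's `FractionalIdeal.count` of a nonzero integral ideal is the tree's `modulusExp` (Neukirch's `n_𝔭`).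
[cite: NeukirchANT1999, Ch. VI §1 Def. (1.7) p. 363] -/
theorem count_coe_eq_modulusExp {K : Type*} [Field K] [NumberField K] {𝔪 : Ideal (𝓞 K)} (h𝔪 : 𝔪 ≠ ⊥)
    (v : HeightOneSpectrum (𝓞 K)) :
    FractionalIdeal.count K v ((𝔪 : Ideal (𝓞 K)) : FractionalIdeal (𝓞 K)⁰ K) = (modulusExp 𝔪 v : ℤ) := by
  rw [FractionalIdeal.count_coe K v (show 𝔪 ≠ 0 from h𝔪), modulusExp]

/-- `(N) ≠ 0` in `𝓞 ℚ` for `N ≠ 0`. [folklore] -/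
private theorem span_natCast_rat_ne_bot {N : ℕ} (hN : N ≠ 0) : (Ideal.span {(N : 𝓞 ℚ)} : Ideal (𝓞 ℚ)) ≠ ⊥ := by
  rw [Ne, Ideal.span_singleton_eq_bot]; exact_mod_cast hN

/-- The case `𝔪 = (N)` over `ℚ`. [folklore] -/
private theorem count_coe_span_eq_modulusExp {N : ℕ} (hN : N ≠ 0) (v : HeightOneSpectrum (𝓞 ℚ)) :
    FractionalIdeal.count ℚ v ((Ideal.span {(N : 𝓞 ℚ)} : Ideal (𝓞 ℚ)) : FractionalIdeal (𝓞 ℚ)⁰ ℚ) =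
      (modulusExp (Ideal.span {(N : 𝓞 ℚ)}) v : ℤ) :=
  count_coe_eq_modulusExp (span_natCast_rat_ne_bot hN) v

/-- **«`χ_cyc(σ) ≡ 1 (mod N)` iff `σ` fixes `μ_N(ℚ̄)`»**: `χ_cyc(σ)` lies in Neukirch's congruence subgroup
`I^{(N)} = ∏_p (1 + N ℤ_p)^×` of `Ẑ^×` iff `σ ∈ Gal(ℚ̄/ℚ(μ_N))` (the tree's `rootsOfUnityFixer ℚ N`).
[cite: MilneCM2006, Ch. II §9, p. 76 («σζ = ζ^{χ_cyc(σ)}»)] [cite: NeukirchANT1999, Ch. VI §1 (1.7)–(1.8)] -/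
theorem cyclotomicFiniteIdele_mem_congruenceUnits_iff (N : ℕ) [NeZero N] (σ : absoluteGaloisGroup ℚ) :
    cyclotomicFiniteIdele σ ∈ IdeleAction.congruenceUnits (K := ℚ) (Ideal.span {(N : 𝓞 ℚ)}) ↔
      σ ∈ rootsOfUnityFixer ℚ N := by
  have h10 : ((1 : ℕ) : ℚ) ≠ 0 := by norm_num
  have hW : principalIdele ℚ (Units.mk0 ((1 : ℕ) : ℚ) h10)⁻¹ * cyclotomicIdele σ = cyclotomicIdele σ := by
    rw [show Units.mk0 ((1 : ℕ) : ℚ) h10 = 1 from Units.ext (by rw [Units.val_mk0, Nat.cast_one, Units.val_one]),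
      inv_one, map_one, one_mul]
  rw [mem_rootsOfUnityFixer_iff, IdeleAction.mem_congruenceUnits_iff]
  constructor
  · intro h t ht
    have hmem : principalIdele ℚ (Units.mk0 ((1 : ℕ) : ℚ) h10)⁻¹ * cyclotomicIdele σ ∈
        congruenceIdeles (Ideal.span {(N : 𝓞 ℚ)}) := by
      rw [hW, mem_congruenceIdeles_iff]
      refine ⟨fun v hv => ?_, fun w hw => ?_⟩
      · rw [cyclotomicIdele_snd, ← coe_cyclotomicFiniteIdele_apply, ← count_coe_span_eq_modulusExp (NeZero.ne N) v]
        exact (h v).2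
      · rw [show ((cyclotomicIdele σ : ideleGroup ℚ) : AdeleRing (𝓞 ℚ) ℚ).1 w = 1 from rfl, map_one]
        exact one_pos
    have h1 := forall_smul_eq_pow_of_mem_congruenceIdeles (N := N) h10 (Nat.coprime_one_left N) hmem t ht
    rwa [pow_one] at h1
  · intro h v
    refine ⟨unitOrd_cyclotomicFiniteIdele σ v, ?_⟩
    rw [count_coe_span_eq_modulusExp (NeZero.ne N) v, coe_cyclotomicFiniteIdele_apply, ← Nat.cast_one,
      valued_cyclotomicLocalUnit_sub_natCast_le_iff]
    intro t ht
    rw [pow_one]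
    exact h t (by
      obtain ⟨c, hc⟩ := natGenerator_pow_modulusExp_dvd v N
      rw [hc, pow_mul, ht, one_pow])

end Level

/-! ## §4. Uniqueness (`Ẑ^×` is separated by the congruence subgroups:
`FiniteIdeleClosure.eq_one_of_forall_mem_congruenceUnits_span_natCast` of `…PrincipalIdelesFiniteClosure`) -/

section Unique

attribute [local instance] Rat.fact_prime_natGenerator

/-- **Finite idèles vs idèles for congruence conditions**: for a unit finite idèle `w` (`ord_v w = 0` everywhere)
and `𝔪 ≠ 0`, `(1, w) ∈ W_𝔪` implies `w ∈ I^𝔪` (the conditions at `v ∤ 𝔪` are automatic for units, the archimedean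
ones hold for the component `1`). [cite: NeukirchANT1999, Ch. VI §1 (1.7) («U_𝔭^{(0)} = U_𝔭») and Remark p. 363] -/
theorem IdeleAction.mem_congruenceUnits_of_units_map_inr_mem_congruenceIdeles {K : Type} [Field K] [NumberField K]
    {𝔪 : Ideal (𝓞 K)} (h𝔪 : 𝔪 ≠ ⊥) {w : (FiniteAdeleRing (𝓞 K) K)ˣ}
    (hw : w ∈ (IdeleIdeal.toIdealUnits (𝓞 K) K).ker)
    (h : Units.map (N := AdeleRing (𝓞 K) K) (MonoidHom.inr (InfiniteAdeleRing K) (FiniteAdeleRing (𝓞 K) K)) w ∈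
      congruenceIdeles 𝔪) :
    w ∈ IdeleAction.congruenceUnits (K := K) 𝔪 := by
  intro v
  have hw' := (IdeleIdeal.mem_ker_toIdealUnits_iff w).mp hw v
  refine ⟨hw', ?_⟩
  rw [count_coe_eq_modulusExp h𝔪 v]
  by_cases hv : modulusExp 𝔪 v = 0
  · rw [hv, Nat.cast_zero, neg_zero, WithZero.exp_zero]
    exact IdeleAction.valued_sub_one_le_one_of_unitOrd_eq_zero hw'
  · exact ((mem_congruenceIdeles_iff).mp h).1 v hv

/-- The converse: `w ∈ I^𝔪` implies `(1, w) ∈ W_𝔪`. [cite: NeukirchANT1999, Ch. VI §1 (1.7) and Remark p. 363] -/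
theorem IdeleAction.units_map_inr_mem_congruenceIdeles_of_mem_congruenceUnits {K : Type} [Field K] [NumberField K]
    {𝔪 : Ideal (𝓞 K)} (h𝔪 : 𝔪 ≠ ⊥) {w : (FiniteAdeleRing (𝓞 K) K)ˣ}
    (h : w ∈ IdeleAction.congruenceUnits (K := K) 𝔪) :
    Units.map (N := AdeleRing (𝓞 K) K) (MonoidHom.inr (InfiniteAdeleRing K) (FiniteAdeleRing (𝓞 K) K)) w ∈
      congruenceIdeles 𝔪 := by
  rw [mem_congruenceIdeles_iff]
  refine ⟨fun v _ => ?_, fun x hx => ?_⟩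
  · have := (h v).2
    rwa [count_coe_eq_modulusExp h𝔪 v] at this
  · rw [show ((Units.map (N := AdeleRing (𝓞 K) K) (MonoidHom.inr (InfiniteAdeleRing K) (FiniteAdeleRing (𝓞 K) K))
        w : ideleGroup K) : AdeleRing (𝓞 K) K).1 x = 1 from rfl, map_one]
    exact one_pos

/-- **UNIQUENESS OF `χ_cyc`**: a unit finite idèle `u ∈ Ẑ^×` such that, for every `N ≥ 1`, `u ≡ n (mod^× N)` for
SOME exponent `n` through which `σ` acts on `μ_N(ℚ̄)`, IS `χ_cyc(σ)` — an element of `Ẑ^× = lim (ℤ/N)^×` is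
determined by its residues.  So `cyclotomicFiniteIdele` is THE map of the print.
[cite: MilneCM2006, Ch. II §9, p. 76 («σζ = ζ^{χ_cyc(σ)} for all roots ζ of 1»)] -/
theorem eq_cyclotomicFiniteIdele_of_forall {σ : absoluteGaloisGroup ℚ} {u : (FiniteAdeleRing (𝓞 ℚ) ℚ)ˣ}
    (hu : u ∈ (IdeleIdeal.toIdealUnits (𝓞 ℚ) ℚ).ker)
    (h : ∀ N : ℕ, N ≠ 0 → ∃ (n : ℕ) (hn0 : (n : ℚ) ≠ 0), n.Coprime N ∧
      (∀ t : AlgebraicClosure ℚ, t ^ N = 1 → σ • t = t ^ n) ∧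
      principalIdele ℚ (Units.mk0 (n : ℚ) hn0)⁻¹ *
          Units.map (N := AdeleRing (𝓞 ℚ) ℚ) (MonoidHom.inr (InfiniteAdeleRing ℚ) (FiniteAdeleRing (𝓞 ℚ) ℚ)) u ∈
        congruenceIdeles (Ideal.span {(N : 𝓞 ℚ)})) :
    u = cyclotomicFiniteIdele σ := by
  rw [← mul_inv_eq_one]
  refine FiniteIdeleClosure.eq_one_of_forall_mem_congruenceUnits_span_natCast ℚ fun N hN0 => ?_
  obtain ⟨n, hn0, hn, hact, hmem⟩ := h N hN0
  have hχ := principalIdele_inv_mul_cyclotomicIdele_mem_congruenceIdeles hn0 hn hact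
  -- the quotient `(1, u χ⁻¹) ∈ W_{(N)}`
  have hq : Units.map (N := AdeleRing (𝓞 ℚ) ℚ) (MonoidHom.inr (InfiniteAdeleRing ℚ) (FiniteAdeleRing (𝓞 ℚ) ℚ))
      (u * (cyclotomicFiniteIdele σ)⁻¹) ∈ congruenceIdeles (Ideal.span {(N : 𝓞 ℚ)}) := by
    have := (congruenceIdeles (Ideal.span {(N : 𝓞 ℚ)})).mul_mem hmem ((congruenceIdeles _).inv_mem hχ)
    rwa [cyclotomicIdele_apply, mul_inv_rev, mul_comm _⁻¹ (principalIdele ℚ _)⁻¹, ← mul_assoc, mul_assoc (principalIdele ℚ _),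
      mul_mul_inv_cancel'_right, ← map_inv, ← map_mul] at this
  exact IdeleAction.mem_congruenceUnits_of_units_map_inr_mem_congruenceIdeles (span_natCast_rat_ne_bot hN0)
    (mul_mem hu (inv_mem (cyclotomicFiniteIdele_mem_ker_toIdealUnits σ))) hq

end Unique

/-! ## §5. Continuity, kernel, complex conjugation -/

section Topology

attribute [local instance] Rat.fact_prime_natGenerator

/-- **`χ_cyc : Γ_ℚ → 𝔸^×_{ℚ,f}` is continuous** (Krull topology / restricted product topology): the preimage of
Neukirch's `I^{(N)}` is `Gal(ℚ̄/ℚ(μ_N))`, an open subgroup, and the `I^𝔪` are a basis of neighbourhoods of `1`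
(`…FiniteIdeleCongruenceSubgroupBasis`). [cite: MilneCM2006, Ch. II §9, p. 76] [cite: NeukirchANT1999, Ch. VI §1 Prop. (1.8)] -/
theorem continuous_cyclotomicFiniteIdele : Continuous cyclotomicFiniteIdele := by
  refine continuous_of_continuousAt_one cyclotomicFiniteIdele ?_
  rw [ContinuousAt, map_one]
  intro U hU
  obtain ⟨𝔪, h𝔪, hsub⟩ := IdeleAction.exists_congruenceUnits_subset_of_mem_nhds hU
  have hN0 : Ideal.absNorm 𝔪 ≠ 0 := fun h0 => h𝔪 (Ideal.absNorm_eq_zero_iff.mp h0)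
  haveI : NeZero (Ideal.absNorm 𝔪) := ⟨hN0⟩
  have hle : Ideal.span {((Ideal.absNorm 𝔪 : ℕ) : 𝓞 ℚ)} ≤ 𝔪 :=
    (Ideal.span_singleton_le_iff_mem _).mpr (Ideal.absNorm_mem 𝔪)
  rw [Filter.mem_map]
  refine Filter.mem_of_superset ((isOpen_rootsOfUnityFixer ℚ (Ideal.absNorm 𝔪)).mem_nhds (one_mem _))
    fun σ hσ => hsub (FiniteIdeleClosure.congruenceUnits_mono ℚ (span_natCast_rat_ne_bot hN0) hle
      ((cyclotomicFiniteIdele_mem_congruenceUnits_iff (Ideal.absNorm 𝔪) σ).mpr hσ))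

/-- `(1, χ_cyc ·) : Γ_ℚ → 𝕀_ℚ` is continuous. [cite: MilneCM2006, Ch. II §9, p. 76] -/
theorem continuous_cyclotomicIdele : Continuous cyclotomicIdele :=
  (Continuous.units_map _ (continuous_const.prodMk continuous_id)).comp continuous_cyclotomicFiniteIdele

/-- **The kernel of `χ_cyc` is `⋂_N Gal(ℚ̄/ℚ(μ_N))`**: `χ_cyc(σ) = 1` iff `σ` fixes every root of unity of `ℚ̄`.
[cite: MilneCM2006, Ch. II §9, p. 76 («σζ = ζ^{χ_cyc(σ)} for all roots ζ of 1»)] -/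
theorem cyclotomicFiniteIdele_eq_one_iff (σ : absoluteGaloisGroup ℚ) :
    cyclotomicFiniteIdele σ = 1 ↔ ∀ (N : ℕ) (t : AlgebraicClosure ℚ), N ≠ 0 → t ^ N = 1 → σ • t = t := by
  constructor
  · intro h N t hN ht
    haveI : NeZero N := ⟨hN⟩
    have h1 : cyclotomicFiniteIdele σ ∈ IdeleAction.congruenceUnits (K := ℚ) (Ideal.span {(N : 𝓞 ℚ)}) := by
      rw [h]; exact one_mem _
    exact (cyclotomicFiniteIdele_mem_congruenceUnits_iff N σ).mp h1 t ht
  · intro h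
    refine FiniteIdeleClosure.eq_one_of_forall_mem_congruenceUnits_span_natCast ℚ fun N hN0 => ?_
    haveI : NeZero N := ⟨hN0⟩
    exact (cyclotomicFiniteIdele_mem_congruenceUnits_iff N σ).mpr fun t ht => h _ t hN0 ht

/-- **An automorphism inverting every root of unity (e.g. a complex conjugation) has `χ_cyc = -1`.**
[cite: MilneCM2006, Ch. II §9, p. 76] [cite: CasselsFrohlichANT1967, Ch. VII §5.7 («ζ^{ψ(x)} = ζ^{u^{-1}}» with u = -1)] -/
theorem cyclotomicFiniteIdele_eq_neg_one_of_forall_smul_eq_inv {c : absoluteGaloisGroup ℚ}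
    (hc : ∀ (N : ℕ) (t : AlgebraicClosure ℚ), N ≠ 0 → t ^ N = 1 → c • t = t⁻¹) :
    cyclotomicFiniteIdele c = -1 := by
  symm
  refine eq_cyclotomicFiniteIdele_of_forall ((IdeleIdeal.mem_ker_toIdealUnits_iff_valued _).mpr fun v => by
    rw [Units.val_neg, Units.val_one, show ((-1 : FiniteAdeleRing (𝓞 ℚ) ℚ)) v = -1 from rfl, Valuation.map_neg,
      map_one]) fun N hN => ?_
  haveI : NeZero N := ⟨hN⟩
  -- exponent `n = 2N - 1 ≡ -1`, prime to `N`
  have hn0 : ((2 * N - 1 : ℕ) : ℚ) ≠ 0 := Nat.cast_ne_zero.mpr (by omega)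
  have hcop : (2 * N - 1).Coprime N := by
    have h1 : Nat.gcd (2 * N - 1) N ∣ 2 * N - (2 * N - 1) :=
      Nat.dvd_sub (Dvd.dvd.mul_left (Nat.gcd_dvd_right _ _) 2) (Nat.gcd_dvd_left _ _)
    rw [show 2 * N - (2 * N - 1) = 1 by omega] at h1
    exact Nat.dvd_one.mp h1
  have hact : ∀ t : AlgebraicClosure ℚ, t ^ N = 1 → c • t = t ^ (2 * N - 1) := fun t ht => by
    rw [hc N t hN ht, show 2 * N - 1 = N + (N - 1) by omega, pow_add, ht, one_mul]
    exact inv_eq_of_mul_eq_one_right (by rw [← pow_succ', show N - 1 + 1 = N by omega, ht])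
  refine ⟨2 * N - 1, hn0, hcop, hact, ?_⟩
  -- `(2N-1)⁻¹ · (1, -1) ∈ W_{(N)}`: finite components `-(2N-1)⁻¹ ≡ 1`, i.e. `|2N|_p ≤ |N|_p`; archimedean `(2N-1)⁻¹ > 0`
  rw [mem_congruenceIdeles_iff]
  refine ⟨fun v hv => ?_, fun w hw => ?_⟩
  · have hpn : ¬ Rat.HeightOneSpectrum.natGenerator v ∣ 2 * N - 1 :=
      not_natGenerator_dvd_of_coprime v hcop (natGenerator_dvd_of_modulusExp_ne_zero v hv)
    have hnv : Valued.v (((2 * N - 1 : ℕ) : ℕ) : v.adicCompletion ℚ) = 1 := valued_natCast_eq_one_of_not_dvd v hpn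
    have hn0' : (((2 * N - 1 : ℕ) : ℕ) : v.adicCompletion ℚ) ≠ 0 := fun h0 => by
      rw [h0, map_zero] at hnv; exact zero_ne_one hnv
    have ha : (((2 * N - 1 : ℕ) : ℕ) : v.adicCompletion ℚ) + 1 = ((2 * N : ℕ) : v.adicCompletion ℚ) := by
      rw [← Nat.cast_succ, show (2 * N - 1).succ = 2 * N by omega]
    rw [ideleGroup_val_snd_mul, principalIdele_snd, Units.val_inv_eq_inv_val, Units.val_mk0, map_inv₀, map_natCast,
      show ((Units.map (N := AdeleRing (𝓞 ℚ) ℚ) (MonoidHom.inr (InfiniteAdeleRing ℚ) (FiniteAdeleRing (𝓞 ℚ) ℚ))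
        (-1 : (FiniteAdeleRing (𝓞 ℚ) ℚ)ˣ) : ideleGroup ℚ) : AdeleRing (𝓞 ℚ) ℚ).2 v = -1 from rfl,
      show (((2 * N - 1 : ℕ) : ℕ) : v.adicCompletion ℚ)⁻¹ * -1 - 1 =
        -((((2 * N - 1 : ℕ) : ℕ) : v.adicCompletion ℚ)⁻¹ * ((2 * N : ℕ) : v.adicCompletion ℚ)) by
        rw [← ha, mul_add, mul_one, inv_mul_cancel₀ hn0']; ring,
      Valuation.map_neg, map_mul, map_inv₀, hnv, inv_one, one_mul, Rat.valued_natCast, Rat.valuation_natCast]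
    exact (intValuation_le_pow_iff_mem v _ _).mpr (Ideal.le_of_dvd (pow_modulusExp_dvd v)
      (by rw [Nat.cast_mul]; exact Ideal.mul_mem_left _ _ (Ideal.mem_span_singleton_self _)))
  · have hpos : (0 : ℝ) < (((2 * N - 1 : ℕ) : ℚ) : ℝ)⁻¹ := inv_pos.mpr (by exact_mod_cast (show 0 < 2 * N - 1 by omega))
    have key : InfinitePlace.Completion.extensionEmbeddingOfIsReal hw
        (((principalIdele ℚ (Units.mk0 ((2 * N - 1 : ℕ) : ℚ) hn0)⁻¹ *
          Units.map (N := AdeleRing (𝓞 ℚ) ℚ) (MonoidHom.inr (InfiniteAdeleRing ℚ) (FiniteAdeleRing (𝓞 ℚ) ℚ))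
            (-1 : (FiniteAdeleRing (𝓞 ℚ) ℚ)ˣ) : ideleGroup ℚ) : AdeleRing (𝓞 ℚ) ℚ).1 w) =
        InfinitePlace.embedding_of_isReal hw (((Units.mk0 ((2 * N - 1 : ℕ) : ℚ) hn0)⁻¹ : ℚˣ) : ℚ) := by
      rw [ideleGroup_val_fst_mul, principalIdele_fst,
        show ((Units.map (N := AdeleRing (𝓞 ℚ) ℚ) (MonoidHom.inr (InfiniteAdeleRing ℚ) (FiniteAdeleRing (𝓞 ℚ) ℚ))
          (-1 : (FiniteAdeleRing (𝓞 ℚ) ℚ)ˣ) : ideleGroup ℚ) : AdeleRing (𝓞 ℚ) ℚ).1 = 1 from rfl, mul_one,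
        InfiniteAdeleRing.algebraMap_apply]
      exact InfinitePlace.Completion.extensionEmbeddingOfIsReal_coe hw (WithAbs.toAbs w.1 _)
    rw [key, Units.val_inv_eq_inv_val, Units.val_mk0, map_inv₀, map_natCast]
    rw [Rat.cast_natCast] at hpos
    exact hpos

/-- **`χ_cyc(complex conjugation) = -1`**: for a complex conjugation `c ∈ Γ_ℚ` (the tree's
`IsComplexConjugation φ c`, `ι(c • x) = conj (ι x)` for an embedding `ι : ℚ̄ → ℂ`), `χ_cyc(c) = -1`
(`conj ζ = ζ⁻¹` on roots of unity). [cite: MilneCM2006, Ch. II §9, p. 76]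
[cite: CasselsFrohlichANT1967, Ch. VII §5.7 (PDF p. 214)] -/
theorem cyclotomicFiniteIdele_of_isComplexConjugation {φ : ℚ →+* ℝ} {c : absoluteGaloisGroup ℚ}
    (hc : IsComplexConjugation φ c) : cyclotomicFiniteIdele c = -1 := by
  refine cyclotomicFiniteIdele_eq_neg_one_of_forall_smul_eq_inv fun N t hN ht => ?_
  obtain ⟨ι, -, hι⟩ := isComplexConjugation_iff.mp hc
  have hzN : (ι t) ^ N = 1 := by rw [← map_pow, ht, map_one]
  have hnorm : ‖ι t‖ = 1 := Complex.norm_eq_one_of_pow_eq_one hzN hN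
  apply ι.injective
  rw [hι, ← Complex.inv_eq_conj hnorm, map_inv₀]

end Topology

/-! ## §6. Factorisation through `Γ_ℚ^ab = Gal(ℚ^ab/ℚ)` -/

section Ab

attribute [local instance] Rat.fact_prime_natGenerator

/-- `closure [Γ_ℚ, Γ_ℚ] ≤ Gal(ℚ̄/ℚ(μ_N))` (the latter is an open, hence closed, subgroup with abelian quotient:
`ℚ(μ_N)/ℚ` is abelian). [cite: NeukirchANT1999, Ch. I §10 (ℚ(ζ_n)/ℚ abelian with group (ℤ/n)^*)] -/
theorem topologicalClosure_commutator_le_rootsOfUnityFixer (N : ℕ) [NeZero N] :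
    (commutator (absoluteGaloisGroup ℚ)).topologicalClosure ≤ rootsOfUnityFixer ℚ N :=
  Subgroup.topologicalClosure_minimal _ (commutator_le_rootsOfUnityFixer ℚ N)
    (Subgroup.isClosed_of_isOpen _ (isOpen_rootsOfUnityFixer ℚ N))

/-- **`χ_cyc` kills `closure [Γ_ℚ, Γ_ℚ]`** (its elements fix every root of unity).
[cite: MilneCM2006, Ch. II §9, Lemma 9.4 («art_ℚ(χ_cyc(σ)) = σ|ℚ^ab» — χ_cyc factors through Gal(ℚ^ab/ℚ))] -/
theorem cyclotomicFiniteIdele_eq_one_of_mem_topologicalClosure_commutator {σ : absoluteGaloisGroup ℚ}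
    (hσ : σ ∈ (commutator (absoluteGaloisGroup ℚ)).topologicalClosure) : cyclotomicFiniteIdele σ = 1 := by
  refine (cyclotomicFiniteIdele_eq_one_iff σ).mpr fun N t hN ht => ?_
  haveI : NeZero N := ⟨hN⟩
  exact topologicalClosure_commutator_le_rootsOfUnityFixer N hσ t ht

/-- `closure [Γ_ℚ, Γ_ℚ] ≤ ker χ_cyc`. [cite: MilneCM2006, Ch. II §9, Lemma 9.4] -/
theorem topologicalClosure_commutator_le_ker_cyclotomicFiniteIdele :
    (commutator (absoluteGaloisGroup ℚ)).topologicalClosure ≤ cyclotomicFiniteIdele.ker :=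
  fun _ hσ => cyclotomicFiniteIdele_eq_one_of_mem_topologicalClosure_commutator hσ

/-- **`χ_cyc` on `Gal(ℚ^ab/ℚ)`**: the factorisation `χ_cyc^ab : Γ_ℚ^ab →* 𝔸^×_{ℚ,f}` of the cyclotomic character
through the topological abelianisation `Γ_ℚ^ab = Γ_ℚ ⧸ closure [Γ_ℚ, Γ_ℚ] = Gal(ℚ^ab/ℚ)` — the map of Lemma 9.4
(«`art_ℚ(χ_cyc(σ)) = σ|ℚ^ab`»). [cite: MilneCM2006, Ch. II §9, Lemma 9.4] -/
def cyclotomicFiniteIdeleAb : absoluteGaloisGroupAbelianization ℚ →* (FiniteAdeleRing (𝓞 ℚ) ℚ)ˣ :=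
  QuotientGroup.lift _ cyclotomicFiniteIdele topologicalClosure_commutator_le_ker_cyclotomicFiniteIdele

/-- `χ_cyc^ab [σ] = χ_cyc σ`. [cite: MilneCM2006, Ch. II §9, Lemma 9.4] -/
@[simp] theorem cyclotomicFiniteIdeleAb_absGaloisAbProj (σ : absoluteGaloisGroup ℚ) :
    cyclotomicFiniteIdeleAb (absGaloisAbProj ℚ σ) = cyclotomicFiniteIdele σ := rfl

/-- `χ_cyc^ab` takes values in `Ẑ^×`. [cite: MilneCM2006, Ch. II §9, p. 76] -/
theorem cyclotomicFiniteIdeleAb_mem_ker_toIdealUnits (g : absoluteGaloisGroupAbelianization ℚ) :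
    cyclotomicFiniteIdeleAb g ∈ (IdeleIdeal.toIdealUnits (𝓞 ℚ) ℚ).ker := by
  obtain ⟨σ, rfl⟩ := QuotientGroup.mk_surjective g
  exact cyclotomicFiniteIdele_mem_ker_toIdealUnits σ

end Ab


end Literature.NumberTheory.NumberFields
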